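import Summits.AtomisticToContinuum.FouriersLaw.Theorems.OddSectorIrreversibilityTapLeakBoundSplitGlue

/-!
# `TapLeakBound` (stmt-AtomisticToContinuum-15159), line `SketchIdeator2`, stub `stub_gaussMoment`

Helper file (`--supports stmt-AtomisticToContinuum-15159`; proves the registered stub `stub_gaussMoment`)
for crux P = `Summit.AtomisticToContinuum.FouriersLaw.Theses.OddSectorIrreversibility.TapLeakBound`
(route `OddSectorIrreversibility`, sub-problem `FouriersLaw`).

**Gaussian moment bound in one momentum (fixed `N`).** Let `μ_T = e^{-H/T} dq dp` be the unnormalised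
Gibbs weight (`gibbsWeight ω₂ lam β γ N T`) of the pinned chain (`ω₂ > 0`, `lam, β ≥ 0`) at `T > 0`, and
`f ∈ C¹` with `f, ∂_{p_b} f ∈ L²(μ_T)`. Then `p_b f ∈ L²(μ_T)` and

  `∫ (p_b f)² dμ_T ≤ 2T ∫ f² dμ_T + 4T² ∫ (∂_{p_b} f)² dμ_T`.

Proof (global, no fibre decomposition). Since `H = Σ_i p_i²/2 + Φ(q)`, `∂_{p_b} e^{-H/T} = -(p_b/T) e^{-H/T}`
(`hasLineDerivAt_gibbsDensity`). For `ε > 0` the regularised test function `F_ε = p_b e^{-ε p_b²} f²`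
is `C¹` along `(0, e_b)` with `∂_{p_b} F_ε = e^{-ε p_b²} (f² − 2ε p_b² f² + 2 p_b f ∂_{p_b} f)`, and
`F_ε e^{-H/T}`, `∂_{p_b}F_ε e^{-H/T}`, `F_ε ∂_{p_b} e^{-H/T}` are Lebesgue integrable (bounded factors
`e^{-ε t²} ≤ 1`, `|t| e^{-ε t²} ≤ 1 + 1/ε`, `t² e^{-ε t²} ≤ 1/ε` times `f²`, `f ∂_{p_b} f ∈ L¹(μ_T)`), so
Mathlib's integration by parts along a line (`integral_mul_eq_neg_of_hasLineDerivAt_of_integrable`) gives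
`A_ε := ∫ p_b² e^{-ε p_b²} f² dμ_T = T ∫ ∂_{p_b} F_ε dμ_T`. Pointwise,
`T ∂_{p_b}F_ε ≤ T f² + ½ p_b² e^{-ε p_b²} f² + 2T² (∂_{p_b} f)²` (drop the signed term, `2xy ≤ x²/2 + 2y²`,
`e^{-ε p_b²} ≤ 1`; `gaussMoment_pointwise`), hence `A_ε ≤ 2T ∫ f² + 4T² ∫ (∂_{p_b} f)²` uniformly in
`ε` (`gaussMoment_reg`). Monotone convergence `ε = 1/(n+1) ↓ 0` (`lintegral_tendsto_of_tendsto_of_monotone`)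
gives `∫ (p_b f)² dμ_T ≤ 2T ∫ f² + 4T² ∫ (∂_{p_b} f)² < ∞`, i.e. both claims. The hypotheses `ω₂ > 0`,
`lam, β ≥ 0` of the registered signature are not used (only `T > 0` and the two `L²(μ_T)` memberships are).
References: folklore (one-dimensional Gaussian integration by parts / the `N(0,T)` bound
`‖t g‖² ≤ 2T‖g‖² + 4T²‖g'‖²`). Nothing here closes the item.
-/

noncomputable section

open MeasureTheory ProbabilityTheory Filter Topology Set Function
open scoped NNReal ENNReal ContDiff

namespace Summit.AtomisticToContinuum.FouriersLaw.Theorems.OddSectorIrreversibility.TapLeak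

open Literature.MathematicalPhysics.KineticTheory.HeatConduction
open Literature.MathematicalPhysics.KineticTheory
open Summit.AtomisticToContinuum.FouriersLaw.Theorems.OddSectorWitness
open Summit.AtomisticToContinuum.FouriersLaw.Theorems.OddSectorIrreversibility.Corrector
open Summit.AtomisticToContinuum.FouriersLaw.Theorems.SubdiffusiveBondHeat

/-! ### The Gaussian regulariser `e^{-ε t²}`: elementary bounds and derivatives -/

/-- `e^{-ε t²} ≤ 1` for `ε ≥ 0`. [folklore] -/
theorem gaussReg_le_one {ε : ℝ} (hε : 0 ≤ ε) (t : ℝ) : Real.exp (-(ε * t ^ 2)) ≤ 1 :=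
  Real.exp_le_one_iff.2 (neg_nonpos.2 (mul_nonneg hε (sq_nonneg t)))

/-- `t² e^{-ε t²} ≤ 1/ε` for `ε > 0` (from `1 + ε t² ≤ e^{ε t²}`). [folklore] -/
theorem sq_mul_gaussReg_le {ε : ℝ} (hε : 0 < ε) (t : ℝ) :
    t ^ 2 * Real.exp (-(ε * t ^ 2)) ≤ 1 / ε := by
  have h1 : ε * t ^ 2 + 1 ≤ Real.exp (ε * t ^ 2) := Real.add_one_le_exp _
  rw [Real.exp_neg, ← div_eq_mul_inv, div_le_div_iff₀ (Real.exp_pos _) hε]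
  nlinarith [sq_nonneg t]

/-- `|t| e^{-ε t²} ≤ 1 + 1/ε` for `ε > 0`. [folklore] -/
theorem abs_mul_gaussReg_le {ε : ℝ} (hε : 0 < ε) (t : ℝ) :
    |t| * Real.exp (-(ε * t ^ 2)) ≤ 1 + 1 / ε := by
  have h1 := sq_mul_gaussReg_le hε t
  have h2 := gaussReg_le_one hε.le t
  have h3 : |t| ≤ 1 + t ^ 2 := by nlinarith [abs_nonneg t, sq_abs t, sq_nonneg (|t| - 1)]
  have h0 := (Real.exp_pos (-(ε * t ^ 2))).le
  calc |t| * Real.exp (-(ε * t ^ 2)) ≤ (1 + t ^ 2) * Real.exp (-(ε * t ^ 2)) :=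
        mul_le_mul_of_nonneg_right h3 h0
    _ = Real.exp (-(ε * t ^ 2)) + t ^ 2 * Real.exp (-(ε * t ^ 2)) := by ring
    _ ≤ 1 + 1 / ε := add_le_add h2 h1

/-- The pointwise absorption inequality behind the moment bound: for `0 ≤ W ≤ 1` and `T, ε > 0`,
`T (W a² − 2ε p² W a² + 2 (pW)(a d)) ≤ T a² + ½ W (p a)² + 2T² d²` (`2xy ≤ x²/2 + 2y²`). [folklore] -/
theorem gaussMoment_pointwise {T ε W p a d : ℝ} (hT : 0 < T) (hε : 0 < ε) (hW0 : 0 ≤ W)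
    (hW1 : W ≤ 1) :
    T * (W * a ^ 2 - 2 * ε * (p ^ 2 * W) * a ^ 2 + 2 * (p * W) * (a * d)) ≤
      T * a ^ 2 + 1 / 2 * (W * (p * a) ^ 2) + 2 * T ^ 2 * d ^ 2 := by
  have h1 : 0 ≤ W * (p * a - 2 * T * d) ^ 2 := mul_nonneg hW0 (sq_nonneg _)
  have h2 : 0 ≤ T * ((1 - W) * a ^ 2) :=
    mul_nonneg hT.le (mul_nonneg (sub_nonneg.2 hW1) (sq_nonneg _))
  have h3 : 0 ≤ T ^ 2 * ((1 - W) * d ^ 2) :=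
    mul_nonneg (sq_nonneg T) (mul_nonneg (sub_nonneg.2 hW1) (sq_nonneg _))
  have h4 : 0 ≤ T * (ε * (p ^ 2 * W * a ^ 2)) := by
    have : 0 ≤ p ^ 2 * W * a ^ 2 := by positivity
    positivity
  nlinarith [h1, h2, h3, h4]

/-- Line derivative of the regularised test function `F_ε(y) = p_b e^{-ε p_b²} f(y)²` along `(0, e_b)`:
`∂_{p_b} F_ε = e^{-ε p_b²} f² − 2ε p_b² e^{-ε p_b²} f² + 2 p_b e^{-ε p_b²} f ∂_{p_b} f`. [folklore] -/
theorem hasLineDerivAt_gaussRegMoment {N : ℕ} (b : Fin N) (ε : ℝ) {f : PhaseSpace N → ℝ}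
    (hfd : Differentiable ℝ f) (x : PhaseSpace N) :
    HasLineDerivAt ℝ (fun y : PhaseSpace N => y.2 b * Real.exp (-(ε * y.2 b ^ 2)) * f y ^ 2)
      (Real.exp (-(ε * x.2 b ^ 2)) * f x ^ 2 -
          (2 * ε * (x.2 b ^ 2 * Real.exp (-(ε * x.2 b ^ 2)))) * f x ^ 2 +
        (2 * (x.2 b * Real.exp (-(ε * x.2 b ^ 2)))) * (f x * partialP b f x)) x
      ((0, Pi.single b 1) : PhaseSpace N) := by
  have h1 : HasDerivAt (fun t : ℝ => x.2 b + t) 1 0 := (hasDerivAt_id' (0 : ℝ)).const_add _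
  have h2 := ((h1.fun_pow 2).const_mul ε).fun_neg.exp
  have h3 : HasDerivAt (fun t : ℝ => f (x + t • ((0, Pi.single b 1) : PhaseSpace N)))
      (partialP b f x) 0 :=
    hasLineDerivAt_partialP hfd b x
  have h4 := (h1.fun_mul h2).fun_mul (h3.fun_pow 2)
  have h2b : ∀ t : ℝ, (x + t • ((0, Pi.single b 1) : PhaseSpace N)).2 b = x.2 b + t := fun t => by
    simp
  unfold HasLineDerivAt
  have hEq : (fun t : ℝ => (fun y : PhaseSpace N => y.2 b * Real.exp (-(ε * y.2 b ^ 2)) * f y ^ 2)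
      (x + t • ((0, Pi.single b 1) : PhaseSpace N))) =
      fun t => (x.2 b + t) * Real.exp (-(ε * (x.2 b + t) ^ 2)) *
        f (x + t • ((0, Pi.single b 1) : PhaseSpace N)) ^ 2 := by
    funext t
    simp only [h2b]
  rw [hEq]
  refine h4.congr_deriv ?_
  simp only [add_zero, zero_smul, Nat.cast_ofNat, pow_one, mul_one, one_mul, Nat.add_one_sub_one]
  ring

/-! ### The regularised bound, uniformly in `ε` -/

/-- **The regularised moment bound.** For `ε > 0` and `f ∈ C¹` with `f, ∂_{p_b} f ∈ L²(μ_T)`: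
`e^{-ε p_b²} (p_b f)² ∈ L¹(μ_T)` (`t² e^{-ε t²} ≤ 1/ε`) and
`∫ e^{-ε p_b²} (p_b f)² dμ_T ≤ 2T ∫ f² dμ_T + 4T² ∫ (∂_{p_b} f)² dμ_T`: integrate `F_ε = p_b e^{-ε p_b²} f²`
by parts against `∂_{p_b} e^{-H/T} = -(p_b/T) e^{-H/T}` (`integral_mul_eq_neg_of_hasLineDerivAt_of_integrable`),
drop the signed term `-2εT ∫ p_b² e^{-ε p_b²} f²` and absorb `2T ∫ p_b e^{-ε p_b²} f ∂_{p_b} f`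
(`gaussMoment_pointwise`). [folklore] -/
theorem gaussMoment_reg {ω₂ lam β γ : ℝ} {T : ℝ} (hT : 0 < T) {N : ℕ} (b : Fin N)
    {f : PhaseSpace N → ℝ} (hf : ContDiff ℝ 1 f) (hf2 : MemLp f 2 (gibbsWeight ω₂ lam β γ N T))
    (hdf : MemLp (partialP b f) 2 (gibbsWeight ω₂ lam β γ N T)) {ε : ℝ} (hε : 0 < ε) :
    Integrable (fun x : PhaseSpace N => Real.exp (-(ε * x.2 b ^ 2)) * (x.2 b * f x) ^ 2)
        (gibbsWeight ω₂ lam β γ N T) ∧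
      ∫ x, Real.exp (-(ε * x.2 b ^ 2)) * (x.2 b * f x) ^ 2 ∂(gibbsWeight ω₂ lam β γ N T) ≤
        2 * T * ∫ x, (f x) ^ 2 ∂(gibbsWeight ω₂ lam β γ N T) +
          4 * T ^ 2 * ∫ x, (partialP b f x) ^ 2 ∂(gibbsWeight ω₂ lam β γ N T) := by
  set μ := gibbsWeight ω₂ lam β γ N T with hμ
  set P := pinnedChain ω₂ lam β γ with hP
  set ρ : PhaseSpace N → ℝ := P.gibbsDensity N T with hρ
  have hfd : Differentiable ℝ f := hf.differentiable one_ne_zero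
  have hfc : Continuous f := hf.continuous
  have hdfc : Continuous (partialP b f) := continuous_partialP hf one_ne_zero b
  have hpc : Continuous fun x : PhaseSpace N => x.2 b := (continuous_apply b).comp continuous_snd
  -- square-integrable data
  have hI1 : Integrable (fun x => f x ^ 2) μ := hf2.integrable_sq
  have hI2 : Integrable (fun x => partialP b f x ^ 2) μ := hdf.integrable_sq
  have hI3 : Integrable (fun x => f x * partialP b f x) μ := hf2.integrable_mul hdf
  -- bounded continuous multipliers of `p_b` preserve integrability
  have hbdd : ∀ (m : ℝ → ℝ) (C : ℝ), Continuous m → (∀ s, |m s| ≤ C) →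
      ∀ {G : PhaseSpace N → ℝ}, Integrable G μ → Integrable (fun x => m (x.2 b) * G x) μ := by
    intro m C hm hle G hG
    refine hG.bdd_mul (c := C) (hm.comp hpc).aestronglyMeasurable (ae_of_all _ fun x => ?_)
    rw [Real.norm_eq_abs]
    exact hle _
  have hw0 : ∀ s : ℝ, 0 < Real.exp (-(ε * s ^ 2)) := fun s => Real.exp_pos _
  have hb1 : ∀ s : ℝ, |Real.exp (-(ε * s ^ 2))| ≤ 1 := fun s => by
    rw [abs_of_pos (hw0 s)]
    exact gaussReg_le_one hε.le s
  have hb2 : ∀ s : ℝ, |s * Real.exp (-(ε * s ^ 2))| ≤ 1 + 1 / ε := fun s => by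
    rw [abs_mul, abs_of_pos (hw0 s)]
    exact abs_mul_gaussReg_le hε s
  have hb3 : ∀ s : ℝ, |s ^ 2 * Real.exp (-(ε * s ^ 2))| ≤ 1 / ε := fun s => by
    rw [abs_of_nonneg (mul_nonneg (sq_nonneg s) (hw0 s).le)]
    exact sq_mul_gaussReg_le hε s
  -- the test function `F = p_b e^{-ε p_b²} f²` and its `p_b`-derivative `F'`
  set F : PhaseSpace N → ℝ := fun y => y.2 b * Real.exp (-(ε * y.2 b ^ 2)) * f y ^ 2 with hF
  set F' : PhaseSpace N → ℝ := fun x => Real.exp (-(ε * x.2 b ^ 2)) * f x ^ 2 -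
      (2 * ε * (x.2 b ^ 2 * Real.exp (-(ε * x.2 b ^ 2)))) * f x ^ 2 +
    (2 * (x.2 b * Real.exp (-(ε * x.2 b ^ 2)))) * (f x * partialP b f x) with hF'
  have hFi : Integrable F μ :=
    hbdd (fun s => s * Real.exp (-(ε * s ^ 2))) (1 + 1 / ε) (by fun_prop) hb2 hI1
  have hF'i : Integrable F' μ := by
    have h1 := hbdd (fun s => Real.exp (-(ε * s ^ 2))) 1 (by fun_prop) hb1 hI1
    have h2 := hbdd (fun s => 2 * ε * (s ^ 2 * Real.exp (-(ε * s ^ 2)))) (2 * ε * (1 / ε))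
      (by fun_prop) (fun s => by
        rw [abs_mul, abs_of_pos (by positivity : (0 : ℝ) < 2 * ε)]
        exact mul_le_mul_of_nonneg_left (hb3 s) (by positivity)) hI1
    have h3 := hbdd (fun s => 2 * (s * Real.exp (-(ε * s ^ 2)))) (2 * (1 + 1 / ε)) (by fun_prop)
      (fun s => by
        rw [abs_mul, abs_two]
        exact mul_le_mul_of_nonneg_left (hb2 s) zero_le_two) hI3
    exact (h1.sub h2).add h3
  have hAi : Integrable (fun x : PhaseSpace N => Real.exp (-(ε * x.2 b ^ 2)) * (x.2 b * f x) ^ 2) μ := by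
    have h := hbdd (fun s => s ^ 2 * Real.exp (-(ε * s ^ 2))) (1 / ε) (by fun_prop) hb3 hI1
    refine h.congr (ae_of_all _ fun x => ?_)
    dsimp only
    ring
  have hFG'i : Integrable (fun x => F x * -(x.2 b / T)) μ := by
    refine (hAi.const_mul (-(1 / T))).congr (ae_of_all _ fun x => ?_)
    simp only [hF]
    ring
  -- transfer to Lebesgue integrals with the density `ρ = e^{-H/T}`
  have hL : ∀ {G : PhaseSpace N → ℝ}, Integrable G μ → Integrable (fun x => G x * ρ x) := by
    intro G hG
    have h := (integrable_gibbsWeight_iff γ N T G).1 hG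
    refine h.congr (ae_of_all _ fun x => ?_)
    dsimp only
    rw [mul_comm]
    rfl
  have hconv : ∀ G : PhaseSpace N → ℝ, ∫ x, G x ∂μ = ∫ x, G x * ρ x := fun G =>
    gaussIBP_integral_gibbsWeight ω₂ lam β γ N T G
  -- integration by parts along `(0, e_b)` against `∂_{p_b} ρ = -(p_b/T) ρ`
  have hFd : ∀ x, HasLineDerivAt ℝ F (F' x) x ((0, Pi.single b 1) : PhaseSpace N) := fun x =>
    hasLineDerivAt_gaussRegMoment b ε hfd x
  have hgd : ∀ x, HasLineDerivAt ℝ ρ (-(x.2 b / T) * ρ x) x ((0, Pi.single b 1) : PhaseSpace N) :=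
    fun x => P.hasLineDerivAt_gibbsDensity (P.hasLineDerivAt_hamiltonian_unitP N x b)
  have hFg'L : Integrable (fun x => F x * (-(x.2 b / T) * ρ x)) := by
    refine (hL hFG'i).congr (ae_of_all _ fun x => ?_)
    dsimp only
    ring
  have hibp : ∫ x, F x * (-(x.2 b / T) * ρ x) = -∫ x, F' x * ρ x :=
    integral_mul_eq_neg_of_hasLineDerivAt_of_integrable (hL hF'i) hFg'L (hL hFi) hFd hgd
  -- back to `μ`: `A = T ∫ F' dμ`
  have h1 : ∫ x, F x * (-(x.2 b / T) * ρ x) =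
      -(1 / T) * ∫ x, Real.exp (-(ε * x.2 b ^ 2)) * (x.2 b * f x) ^ 2 ∂μ := by
    rw [← integral_const_mul, hconv]
    refine integral_congr_ae (ae_of_all _ fun x => ?_)
    simp only [hF]
    ring
  have h2 : ∫ x, F' x * ρ x = ∫ x, F' x ∂μ := (hconv F').symm
  have hAeq : ∫ x, Real.exp (-(ε * x.2 b ^ 2)) * (x.2 b * f x) ^ 2 ∂μ = T * ∫ x, F' x ∂μ := by
    rw [h1, h2] at hibp
    have hT0 : T ≠ 0 := hT.ne'
    have h := congrArg (fun z => -T * z) hibp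
    simp only [← mul_assoc, mul_neg, neg_mul, neg_neg, mul_one_div_cancel hT0, one_mul] at h
    exact h
  -- the pointwise absorption and integration
  have hpt : ∀ x, T * F' x ≤ T * f x ^ 2 + 1 / 2 * (Real.exp (-(ε * x.2 b ^ 2)) * (x.2 b * f x) ^ 2) +
      2 * T ^ 2 * partialP b f x ^ 2 := fun x =>
    gaussMoment_pointwise hT hε (hw0 _).le (gaussReg_le_one hε.le _)
  have hRi : Integrable (fun x => T * f x ^ 2 + 1 / 2 * (Real.exp (-(ε * x.2 b ^ 2)) * (x.2 b * f x) ^ 2) +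
      2 * T ^ 2 * partialP b f x ^ 2) μ :=
    ((hI1.const_mul T).add (hAi.const_mul (1 / 2))).add (hI2.const_mul (2 * T ^ 2))
  have hmono : ∫ x, T * F' x ∂μ ≤ ∫ x, (T * f x ^ 2 +
      1 / 2 * (Real.exp (-(ε * x.2 b ^ 2)) * (x.2 b * f x) ^ 2) + 2 * T ^ 2 * partialP b f x ^ 2) ∂μ :=
    integral_mono (hF'i.const_mul T) hRi hpt
  have hsplit : ∫ x, (T * f x ^ 2 + 1 / 2 * (Real.exp (-(ε * x.2 b ^ 2)) * (x.2 b * f x) ^ 2) +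
      2 * T ^ 2 * partialP b f x ^ 2) ∂μ =
      T * ∫ x, f x ^ 2 ∂μ + 1 / 2 * ∫ x, Real.exp (-(ε * x.2 b ^ 2)) * (x.2 b * f x) ^ 2 ∂μ +
        2 * T ^ 2 * ∫ x, partialP b f x ^ 2 ∂μ := by
    rw [integral_add ((hI1.const_mul T).fun_add (hAi.const_mul (1 / 2))) (hI2.const_mul (2 * T ^ 2)),
      integral_add (hI1.const_mul T) (hAi.const_mul (1 / 2)), integral_const_mul, integral_const_mul,
      integral_const_mul]
  refine ⟨hAi, ?_⟩
  rw [integral_const_mul, hsplit, ← hAeq] at hmono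
  linarith

/-! ### The stub -/

/-- STUB B `stub_gaussMoment` of line `SketchIdeator2` (fixed `N`; one-dimensional Gaussian bookkeeping in
the momentum `p_b`, whose `μ_T`-conditional law is `N(0,T)`): for `f ∈ C¹` with `f, ∂_{p_b}f ∈ L²(μ_T)`,
`p_b f ∈ L²(μ_T)` and `‖p_b f‖² ≤ 2T‖f‖² + 4T²‖∂_{p_b}f‖²`. Proof: the regularised bound
`gaussMoment_reg` (`e^{-ε p_b²}` inserted, uniform in `ε`) and monotone convergence `ε = 1/(n+1) ↓ 0`
(`lintegral_tendsto_of_tendsto_of_monotone`). [folklore] -/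
theorem stub_gaussMoment : ∀ {ω₂ lam β γ : ℝ}, 0 < ω₂ → 0 ≤ lam → 0 ≤ β → ∀ {T : ℝ}, 0 < T →
    ∀ {N : ℕ} (b : Fin N) {f : PhaseSpace N → ℝ}, ContDiff ℝ 1 f →
    MemLp f 2 (gibbsWeight ω₂ lam β γ N T) → MemLp (partialP b f) 2 (gibbsWeight ω₂ lam β γ N T) →
    MemLp (fun x : PhaseSpace N => x.2 b * f x) 2 (gibbsWeight ω₂ lam β γ N T) ∧
    ∫ x, (x.2 b * f x) ^ 2 ∂(gibbsWeight ω₂ lam β γ N T) ≤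
      2 * T * ∫ x, (f x) ^ 2 ∂(gibbsWeight ω₂ lam β γ N T) +
        4 * T ^ 2 * ∫ x, (partialP b f x) ^ 2 ∂(gibbsWeight ω₂ lam β γ N T) := by
  intro ω₂ lam β γ _ _ _ T hT N b f hf hf2 hdf
  set μ := gibbsWeight ω₂ lam β γ N T with hμ
  set B : ℝ := 2 * T * ∫ x, (f x) ^ 2 ∂μ + 4 * T ^ 2 * ∫ x, (partialP b f x) ^ 2 ∂μ with hB
  have hB0 : 0 ≤ B := by
    have h1 : 0 ≤ ∫ x, (f x) ^ 2 ∂μ := integral_nonneg fun x => sq_nonneg _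
    have h2 : 0 ≤ ∫ x, (partialP b f x) ^ 2 ∂μ := integral_nonneg fun x => sq_nonneg _
    positivity
  have hfc : Continuous f := hf.continuous
  have hpf : Continuous fun x : PhaseSpace N => x.2 b * f x := by fun_prop
  have hgc : Continuous fun x : PhaseSpace N => (x.2 b * f x) ^ 2 := by fun_prop
  have hgnc : ∀ n : ℕ, Continuous fun x : PhaseSpace N =>
      Real.exp (-(1 / ((n : ℝ) + 1) * x.2 b ^ 2)) * (x.2 b * f x) ^ 2 := fun n => by fun_prop
  -- the regularised bounds, as bounds on lower Lebesgue integrals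
  have hlev : ∀ n : ℕ,
      ∫⁻ x, ENNReal.ofReal (Real.exp (-(1 / ((n : ℝ) + 1) * x.2 b ^ 2)) * (x.2 b * f x) ^ 2) ∂μ ≤
        ENNReal.ofReal B := by
    intro n
    have hε : (0 : ℝ) < 1 / ((n : ℝ) + 1) := Nat.one_div_pos_of_nat
    obtain ⟨hint, hle⟩ := gaussMoment_reg hT b hf hf2 hdf hε
    rw [← ofReal_integral_eq_lintegral_ofReal hint
      (ae_of_all _ fun x => mul_nonneg (Real.exp_pos _).le (sq_nonneg _))]
    exact ENNReal.ofReal_le_ofReal hle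
  -- monotone convergence `ε = 1/(n+1) ↓ 0`
  have hmono : ∀ x : PhaseSpace N, Monotone fun n : ℕ =>
      ENNReal.ofReal (Real.exp (-(1 / ((n : ℝ) + 1) * x.2 b ^ 2)) * (x.2 b * f x) ^ 2) := by
    intro x m n hmn
    refine ENNReal.ofReal_le_ofReal (mul_le_mul_of_nonneg_right ?_ (sq_nonneg _))
    refine Real.exp_le_exp.2 (neg_le_neg (mul_le_mul_of_nonneg_right ?_ (sq_nonneg _)))
    have h : (m : ℝ) ≤ n := by exact_mod_cast hmn
    exact one_div_le_one_div_of_le (by positivity) (by linarith)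
  have htend : ∀ x : PhaseSpace N, Tendsto (fun n : ℕ =>
      ENNReal.ofReal (Real.exp (-(1 / ((n : ℝ) + 1) * x.2 b ^ 2)) * (x.2 b * f x) ^ 2)) atTop
      (𝓝 (ENNReal.ofReal ((x.2 b * f x) ^ 2))) := by
    intro x
    refine ENNReal.tendsto_ofReal ?_
    have hc : Continuous fun ε : ℝ => Real.exp (-(ε * x.2 b ^ 2)) * (x.2 b * f x) ^ 2 := by fun_prop
    have h := (hc.tendsto 0).comp (tendsto_one_div_add_atTop_nhds_zero_nat (𝕜 := ℝ))
    simp only [zero_mul, neg_zero, Real.exp_zero, one_mul] at h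
    exact h
  have hlim : Tendsto (fun n : ℕ => ∫⁻ x, ENNReal.ofReal
      (Real.exp (-(1 / ((n : ℝ) + 1) * x.2 b ^ 2)) * (x.2 b * f x) ^ 2) ∂μ) atTop
      (𝓝 (∫⁻ x, ENNReal.ofReal ((x.2 b * f x) ^ 2) ∂μ)) :=
    lintegral_tendsto_of_tendsto_of_monotone
      (fun n => (hgnc n).measurable.ennreal_ofReal.aemeasurable) (ae_of_all _ hmono)
      (ae_of_all _ htend)
  have hbound : ∫⁻ x, ENNReal.ofReal ((x.2 b * f x) ^ 2) ∂μ ≤ ENNReal.ofReal B :=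
    le_of_tendsto' hlim hlev
  -- conclusions
  have hgi : Integrable (fun x : PhaseSpace N => (x.2 b * f x) ^ 2) μ :=
    ⟨hgc.aestronglyMeasurable, (hasFiniteIntegral_iff_ofReal (ae_of_all _ fun x => sq_nonneg _)).2
      (hbound.trans_lt ENNReal.ofReal_lt_top)⟩
  refine ⟨(memLp_two_iff_integrable_sq hpf.aestronglyMeasurable).2 hgi, ?_⟩
  rw [integral_eq_lintegral_of_nonneg_ae (ae_of_all _ fun x => sq_nonneg _) hgc.aestronglyMeasurable]
  calc (∫⁻ x, ENNReal.ofReal ((x.2 b * f x) ^ 2) ∂μ).toReal ≤ (ENNReal.ofReal B).toReal :=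
        ENNReal.toReal_mono ENNReal.ofReal_ne_top hbound
    _ = B := ENNReal.toReal_ofReal hB0

end Summit.AtomisticToContinuum.FouriersLaw.Theorems.OddSectorIrreversibility.TapLeak

end
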